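import Literature.Geometry.Kaehler.ChartInnerComplex
import Literature.Geometry.Kaehler.TorusTransferOps
import Literature.Analysis.FunctionSpaces.TorusVectorParseval
import Literature.Analysis.FunctionSpaces.TorusFourierCalculus
import Literature.Analysis.FunctionSpaces.LatticePairing
import HarnessLib

/-!
# The weighted pairing on the torus: `⟪α, β⟫_{L²(M)} = ∫_{𝕋ⁿ} ⟪W(x) Tα(x), Tβ(x)⟫` (Warner 6.32 (2))

F. W. Warner, GTM 94 (1983), 6.32 (2): the inner product of `M` transferred to Euclidean space is
`⟨φ, Aψ⟩` with a smooth positive Hermitian matrix function `A`. For the transfer `T` of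
`ChartTorusTransfer` (fibre identification `ι : Λ^j_ℂ ≃ ℂ^N`, cube map of `A`, cut-off data `𝒞`) we
construct the weight operator `weightOp y : ℂ^N →L[ℝ] ℂ^N` at a chart point `y` (explicitly:
`ε · c · vol̂(y) · ∑_s φ_s(·) r_s(y)` with the frame evaluations `φ_s` and their Riesz vectors
`r_s`, so that `⟪weightOp y a, b⟫ = ε c vol̂(y) · frameInnerC y (ι⁻¹a) (ι⁻¹b)`), its smooth periodic
version `weightPer` (cut off and periodised), and prove

* `CL2SmoothForms.inner_mk_eq_integral_weightOp` — `⟪mk α, mk β⟫ = ∫ ⟪weightPer x (Tα x), Tβ x⟫ dx`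
  for smooth complex `j`-forms supported in the chart preimage of the inner cube region;
* `Torus.pairing_mFourierCoeff_eq_integral_inner` — polarised vector Parseval; hence
* `CL2SmoothForms.inner_mk_eq_pairing` — `⟪mk α, mk β⟫ = ⟨𝓕(weightPer · Tα), 𝓕(Tβ)⟩`.

## References

* F. W. Warner, GTM 94 (1983), 6.32 (2). [WarnerGTM94]
-/

noncomputable section

open scoped Manifold ContDiff Topology ComplexConjugate ComplexInnerProductSpace NNReal
open Bundle Module Set Filter MeasureTheory Complex Metric Function UnitAddTorus
open Literature.Analysis.FunctionSpaces Literature.NumberTheory.Transcendental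

set_option maxSynthPendingDepth 2

namespace Literature.Geometry.Kaehler

/-! ### Riesz vectors of the frame evaluations -/

section Riesz

variable {E : Type*} [NormedAddCommGroup E] [NormedSpace ℝ E] {n : ℕ} [Fact (finrank ℝ E = n)] [FiniteDimensional ℝ E]
  {M : Type*} [TopologicalSpace M] [ChartedSpace E M] [IsManifold 𝓘(ℝ, E) ∞ M]
  [RiemannianBundle (fun x : M ↦ TangentSpace 𝓘(ℝ, E) x)] {j N : ℕ}
  (p : M) (ι : (E [⋀^Fin j]→L[ℝ] ℂ) ≃L[ℂ] EuclideanSpace ℂ (Fin N))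

/-- The `s`-th frame tuple `(e_{s₁}(y), …, e_{s_j}(y))` in the chart at `p`. [folklore] -/
def frameTuple (s : Set.powersetCard (Fin n) j) (y : E) : Fin j → E :=
  fun i ↦ onFrameModel 𝓘(ℝ, E) p ((extChartAt 𝓘(ℝ, E) p).symm y) (Set.powersetCard.ofFinEmbEquiv.symm s i)

/-- The frame evaluation `φ_s(v) = (ι⁻¹ v)(e_s(y))`, a real-linear functional on `ℂ^N`. [folklore] -/
def evalFrame (s : Set.powersetCard (Fin n) j) (y : E) : EuclideanSpace ℂ (Fin N) →L[ℝ] ℂ :=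
  (ContinuousAlternatingMap.apply ℝ E ℂ (frameTuple p s y)).comp
    ((ι.symm : EuclideanSpace ℂ (Fin N) →L[ℂ] (E [⋀^Fin j]→L[ℝ] ℂ)).restrictScalars ℝ)

/-- Unfolding of the frame evaluation. [folklore] -/
@[simp] theorem evalFrame_apply (s : Set.powersetCard (Fin n) j) (y : E) (v : EuclideanSpace ℂ (Fin N)) :
    evalFrame p ι s y v = (ι.symm v) (frameTuple p s y) := rfl

/-- The frame evaluation is complex-linear. [folklore] -/
theorem evalFrame_smul (s : Set.powersetCard (Fin n) j) (y : E) (c : ℂ) (v : EuclideanSpace ℂ (Fin N)) :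
    evalFrame p ι s y (c • v) = c * evalFrame p ι s y v := by
  rw [evalFrame_apply, evalFrame_apply, map_smul, ContinuousAlternatingMap.smul_apply, smul_eq_mul]

/-- **The Riesz vector** `r_s(y)` of the frame evaluation: `⟪r_s(y), v⟫ = φ_s(v)`; explicitly
`(r_s)_i = conj φ_s(eᵢ)`. [folklore] -/
def rieszFrame (s : Set.powersetCard (Fin n) j) (y : E) : EuclideanSpace ℂ (Fin N) :=
  WithLp.toLp 2 fun i ↦ conj (evalFrame p ι s y (EuclideanSpace.single i (1 : ℂ)))

/-- **`⟪r_s(y), v⟫ = φ_s(v)`.** [folklore] -/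
theorem inner_rieszFrame (s : Set.powersetCard (Fin n) j) (y : E) (v : EuclideanSpace ℂ (Fin N)) :
    ⟪rieszFrame p ι s y, v⟫ = evalFrame p ι s y v := by
  have hv : v = ∑ i, v i • EuclideanSpace.single i (1 : ℂ) := by
    conv_lhs => rw [← (EuclideanSpace.basisFun (Fin N) ℂ).sum_repr v]
    simp [EuclideanSpace.basisFun_apply]
  conv_rhs => rw [hv]
  rw [map_sum]
  simp only [rieszFrame, PiLp.inner_apply, evalFrame_smul]
  refine Finset.sum_congr rfl fun i _ ↦ ?_
  simp

end Riesz

/-! ### The weight operator -/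

section Weight

variable {E : Type*} [NormedAddCommGroup E] [NormedSpace ℂ E] [FiniteDimensional ℂ E]
  {n : ℕ} [Fact (finrank ℝ E = n)] [MeasurableSpace E] [BorelSpace E]
  {M : Type*} [TopologicalSpace M] [ChartedSpace E M] [T2Space M] [CompactSpace M]
  [IsManifold 𝓘(ℝ, E) ∞ M] [RiemannianBundle (fun x : M ↦ TangentSpace 𝓘(ℝ, E) x)]
  [IsContMDiffRiemannianBundle 𝓘(ℝ, E) ∞ E (fun x : M ↦ TangentSpace 𝓘(ℝ, E) x)]
  (o : (x : M) → Orientation ℝ (TangentSpace 𝓘(ℝ, E) x) (Fin n)) {j N : ℕ}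
  [Fact (IsSmoothForm (riemannianVolumeForm o))]
  (p : M) (A : E ≃L[ℝ] EuclideanSpace ℝ (Fin n)) (ι : (E [⋀^Fin j]→L[ℝ] ℂ) ≃L[ℂ] EuclideanSpace ℂ (Fin N))

/-- The scalar weight `ε · c · vol̂(y)` (chart sign, cube-map Jacobian factor, volume density). [folklore] -/
def scalarWeight (εs : ℝ) (y : E) : ℝ :=
  εs * (cubeMapFactor A (extChartAt 𝓘(ℝ, E) p p) (modelBasis E n) : ℝ) *
    (riemannianVolumeForm o).inChart p y (modelBasis E n)

/-- **The weight operator** `W(y) = ε c vol̂(y) ∑_s φ_s(·) r_s(y)` on `ℂ^N` (Warner's matrix `A` at the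
chart point `y`, 6.32 (2)). [cite: WarnerGTM94, 6.32 (2)] -/
def weightOp (εs : ℝ) (y : E) : EuclideanSpace ℂ (Fin N) →L[ℝ] EuclideanSpace ℂ (Fin N) :=
  scalarWeight o p A εs y • ∑ s : Set.powersetCard (Fin n) j, (evalFrame p ι s y).smulRight (rieszFrame p ι s y)

omit [T2Space M] [CompactSpace M] [IsContMDiffRiemannianBundle 𝓘(ℝ, E) ∞ E (fun x : M ↦ TangentSpace 𝓘(ℝ, E) x)]
  [Fact (IsSmoothForm (riemannianVolumeForm o))] in
/-- Unfolding of the weight operator. [folklore] -/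
theorem weightOp_apply (εs : ℝ) (y : E) (v : EuclideanSpace ℂ (Fin N)) :
    weightOp o p A ι εs y v = scalarWeight o p A εs y • ∑ s : Set.powersetCard (Fin n) j,
      evalFrame p ι s y v • rieszFrame p ι s y := by
  simp [weightOp]

omit [T2Space M] [CompactSpace M] [IsContMDiffRiemannianBundle 𝓘(ℝ, E) ∞ E (fun x : M ↦ TangentSpace 𝓘(ℝ, E) x)]
  [Fact (IsSmoothForm (riemannianVolumeForm o))] in
/-- **`⟪W(y) a, b⟫ = ε c vol̂(y) · frameInnerC y (ι⁻¹ a) (ι⁻¹ b)`.** [cite: WarnerGTM94, 6.32 (2)] -/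
theorem inner_weightOp (εs : ℝ) (y : E) (a b : EuclideanSpace ℂ (Fin N)) :
    ⟪weightOp o p A ι εs y a, b⟫ = ((scalarWeight o p A εs y : ℝ) : ℂ) *
      frameInnerC (I := 𝓘(ℝ, E)) n j p y (ι.symm a) (ι.symm b) := by
  rw [weightOp_apply, RCLike.real_smul_eq_coe_smul (K := ℂ) (scalarWeight o p A εs y)
    (∑ s : Set.powersetCard (Fin n) j, evalFrame p ι s y a • rieszFrame p ι s y), inner_smul_left, RCLike.conj_ofReal]
  congr 1
  simp only [sum_inner, inner_smul_left, inner_rieszFrame, evalFrame_apply, frameInnerC]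
  rfl

end Weight

/-! ### The `L²` product as a torus integral -/

section TorusIntegral

variable {E : Type*} [NormedAddCommGroup E] [NormedSpace ℂ E] [FiniteDimensional ℂ E]
  {n : ℕ} [Fact (finrank ℝ E = n)] [MeasurableSpace E] [BorelSpace E]
  {M : Type*} [TopologicalSpace M] [ChartedSpace E M] [T2Space M] [CompactSpace M]
  [IsManifold 𝓘(ℝ, E) ∞ M] [RiemannianBundle (fun x : M ↦ TangentSpace 𝓘(ℝ, E) x)]
  [IsContMDiffRiemannianBundle 𝓘(ℝ, E) ∞ E (fun x : M ↦ TangentSpace 𝓘(ℝ, E) x)]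
  (o : (x : M) → Orientation ℝ (TangentSpace 𝓘(ℝ, E) x) (Fin n)) {j N : ℕ}
  [Fact (IsSmoothForm (riemannianVolumeForm o))]
  {p : M} {A : E ≃L[ℝ] EuclideanSpace ℝ (Fin n)} (ι : (E [⋀^Fin j]→L[ℝ] ℂ) ≃L[ℂ] EuclideanSpace ℂ (Fin N))

omit [MeasurableSpace E] [BorelSpace E] [T2Space M] [CompactSpace M] in
/-- The flat complex integrand `vol̂ · frameInnerC(α̂, β̂)` is smooth on the chart target. [folklore] -/
theorem contDiffOn_frameInnerC_chartRep {α β : MForm 𝓘(ℝ, E) M ℂ j} (hα : IsSmoothForm α) (hβ : IsSmoothForm β) (p : M) :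
    ContDiffOn ℝ ∞ (fun y ↦ (((riemannianVolumeForm o).inChart p y (modelBasis E n) : ℝ) : ℂ) *
      frameInnerC (I := 𝓘(ℝ, E)) n j p y (MForm.chartRep p α y) (MForm.chartRep p β y)) (extChartAt 𝓘(ℝ, E) p).target := by
  have ho : IsSmoothForm (riemannianVolumeForm o) := Fact.out
  have hrep : ∀ {γ : MForm 𝓘(ℝ, E) M ℂ j}, IsSmoothForm γ → ContDiffOn ℝ ∞ (MForm.chartRep p γ) (extChartAt 𝓘(ℝ, E) p).target :=
    fun hγ ↦ (hγ.contDiffOn_inChart_target p).congr fun y hy ↦ MForm.chartRep_of_mem p _ hy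
  intro y hy
  have hf : ∀ (s : Set.powersetCard (Fin n) j) i, ContDiffWithinAt ℝ ∞ (fun y ↦ frameTuple p s y i)
      (extChartAt 𝓘(ℝ, E) p).target y := fun s i ↦ contDiffOn_onFrameModel 𝓘(ℝ, E) p _ y hy
  change ContDiffWithinAt ℝ ∞ (fun y ↦ (((riemannianVolumeForm o).inChart p y (modelBasis E n) : ℝ) : ℂ) *
    ∑ s : Set.powersetCard (Fin n) j, conj ((MForm.chartRep p α y) (frameTuple p s y)) *
      (MForm.chartRep p β y) (frameTuple p s y)) (extChartAt 𝓘(ℝ, E) p).target y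
  have hv : ContDiffWithinAt ℝ ∞ (fun y ↦ (riemannianVolumeForm o).inChart p y) (extChartAt 𝓘(ℝ, E) p).target y :=
    (ho.contDiffOn_inChart p) y hy
  have hA' : ContDiffWithinAt ℝ ∞ (MForm.chartRep p α) (extChartAt 𝓘(ℝ, E) p).target y := hrep hα y hy
  have hB' : ContDiffWithinAt ℝ ∞ (MForm.chartRep p β) (extChartAt 𝓘(ℝ, E) p).target y := hrep hβ y hy
  refine (ofRealCLM.contDiff.comp_contDiffWithinAt
    (ContDiffWithinAt.continuousAlternatingMap_apply_const hv _)).mul (ContDiffWithinAt.sum fun s _ ↦ ?_)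
  exact (Complex.conjCLE.contDiff.comp_contDiffWithinAt (ContDiffWithinAt.continuousAlternatingMap_apply hA' (hf s))).mul
    (ContDiffWithinAt.continuousAlternatingMap_apply hB' (hf s))

omit [T2Space M] [CompactSpace M] [MeasurableSpace E] [BorelSpace E] [Fact (IsSmoothForm (riemannianVolumeForm o))]
  [IsContMDiffRiemannianBundle 𝓘(ℝ, E) ∞ E (fun x : M ↦ TangentSpace 𝓘(ℝ, E) x)] in
/-- The frame weight vanishes when the second slot does. [folklore] -/
theorem frameInnerC_zero_right (p : M) (y : E) (a : E [⋀^Fin j]→L[ℝ] ℂ) :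
    frameInnerC (I := 𝓘(ℝ, E)) n j p y a 0 = 0 := by
  simp [frameInnerC]

/-- **`⟪mk α, mk β⟫ = ∫_{𝕋ⁿ} ⟪W(y(x)) Tα(x), Tβ(x)⟫ dx`** for smooth complex `j`-forms supported in the
chart preimage of the inner cube region `K_ρ` (constant chart sign `ε` there), `y(x) = Φ⁻¹(repr x)`:
Warner's `⟨φ, ψ⟩' = ⟨φ, Aψ⟩` with the roles of the slots exchanged by Hermitian symmetry.
[cite: WarnerGTM94, 6.32 (2)] -/
theorem CL2SmoothForms.inner_mk_eq_integral_inner_weightOp (𝒞 : CubeCutoff p A) {εs : ℝ}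
    (hsign : ∀ y ∈ cubeRegion A (extChartAt 𝓘(ℝ, E) p p) 𝒞.ρ, chartSign o p y = εs)
    {α β : MForm 𝓘(ℝ, E) M ℂ j} (hα : IsSmoothForm α) (hβ : IsSmoothForm β)
    (hKβ : ∀ x, β x ≠ 0 → x ∈ (extChartAt 𝓘(ℝ, E) p).source ∧
      extChartAt 𝓘(ℝ, E) p x ∈ cubeRegion A (extChartAt 𝓘(ℝ, E) p p) 𝒞.ρ) :
    ⟪CL2SmoothForms.mk o α hα, CL2SmoothForms.mk o β hβ⟫ =
      ∫ x, ⟪weightOp o p A ι εs ((cubeMap A (extChartAt 𝓘(ℝ, E) p p)).symm (Torus.repr x))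
          (MForm.toTorus p A ((ι : (E [⋀^Fin j]→L[ℝ] ℂ) →L[ℂ] EuclideanSpace ℂ (Fin N)).restrictScalars ℝ) α x),
        MForm.toTorus p A ((ι : (E [⋀^Fin j]→L[ℝ] ℂ) →L[ℂ] EuclideanSpace ℂ (Fin N)).restrictScalars ℝ) β x⟫ := by
  set y₀ := extChartAt 𝓘(ℝ, E) p p with hy₀
  set Φ := cubeMap A y₀ with hΦ
  have hKc := isCompact_cubeRegion (A := A) (y₀ := y₀) 𝒞.ρ
  have hKt : cubeRegion A y₀ 𝒞.ρ ⊆ (extChartAt 𝓘(ℝ, E) p).target := 𝒞.region_mono.trans 𝒞.region_subset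
  -- Step A: the chart formula
  have h1 := CL2SmoothForms.inner_mk_eq_integral_frameInnerC o hα hβ p hKc hKt hKβ hsign
  -- the flat integrand and its pull-back to `ℝⁿ`
  set G : E → ℂ := fun y ↦ (((riemannianVolumeForm o).inChart p y (modelBasis E n) : ℝ) : ℂ) *
    frameInnerC (I := 𝓘(ℝ, E)) n j p y (MForm.chartRep p α y) (MForm.chartRep p β y) with hG
  set g : EuclideanSpace ℝ (Fin n) → ℂ := fun z ↦ G (Φ.symm z) with hg
  have hg0 : ∀ z ∉ closedBall (Torus.cubeCenter (Fin n)) 𝒞.ρ, g z = 0 := fun z hz ↦ by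
    have hz' : Φ.symm z ∉ cubeRegion A y₀ 𝒞.ρ := by rwa [mem_cubeRegion_iff, hΦ, Homeomorph.apply_symm_apply]
    simp only [hg, hG, MForm.chartRep_eq_zero p β hKβ hz', frameInnerC_zero_right, mul_zero]
  -- continuity of `g`
  have hGc : ContinuousOn G (extChartAt 𝓘(ℝ, E) p).target := (contDiffOn_frameInnerC_chartRep o hα hβ p).continuousOn
  have hgc : Continuous g := by
    rw [continuous_iff_continuousAt]
    intro z
    by_cases hz : Φ.symm z ∈ (extChartAt 𝓘(ℝ, E) p).target
    · have hU : IsOpen (Φ.symm ⁻¹' (extChartAt 𝓘(ℝ, E) p).target) :=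
        (isOpen_extChartAt_target p).preimage Φ.symm.continuous
      exact ((hGc.comp Φ.symm.continuous.continuousOn fun _ h ↦ h).continuousAt (hU.mem_nhds hz))
    · have hz' : z ∉ closedBall (Torus.cubeCenter (Fin n)) 𝒞.ρ' := fun h ↦ hz (𝒞.region_subset (by
        rw [mem_cubeRegion_iff, hΦ, Homeomorph.apply_symm_apply]; exact h))
      have hev : g =ᶠ[𝓝 z] fun _ ↦ 0 := by
        filter_upwards [isClosed_closedBall.isOpen_compl.mem_nhds hz'] with z' hz''
        exact hg0 z' fun h ↦ hz'' (closedBall_subset_closedBall 𝒞.ρ_lt.le h)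
      exact (continuousAt_const.congr hev.symm)
  -- Step B: change of variables `E → ℝⁿ → 𝕋ⁿ`
  have h2 : ∫ y, G y ∂(modelBasis E n).addHaar = cubeMapFactor A y₀ (modelBasis E n) • ∫ z, g z := by
    have := integral_comp_cubeMap (A := A) (y₀ := y₀) (modelBasis E n) g
    have hcomp : (fun y ↦ g (cubeMap A y₀ y)) = G := by
      funext y; simp only [hg, hΦ, Homeomorph.symm_apply_apply]
    rwa [hcomp] at this
  have h3 : ∫ z, g z = ∫ x, g (Torus.repr x) := by
    rw [← Torus.integral_periodize_of_cube hgc isClosed_closedBall (closedBall_cubeCenter_subset 𝒞.ρ_lt_half) hg0]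
    refine integral_congr_ae (Eventually.of_forall fun x ↦ ?_)
    exact Torus.periodize_eq_apply_repr (fun z hz ↦ hg0 z fun h ↦ hz (closedBall_cubeCenter_subset 𝒞.ρ_lt_half h)) x
  -- Step C: the torus integrand is the weighted inner product
  have h4 : ∀ x, ⟪weightOp o p A ι εs (Φ.symm (Torus.repr x))
      (MForm.toTorus p A ((ι : (E [⋀^Fin j]→L[ℝ] ℂ) →L[ℂ] EuclideanSpace ℂ (Fin N)).restrictScalars ℝ) α x),
      MForm.toTorus p A ((ι : (E [⋀^Fin j]→L[ℝ] ℂ) →L[ℂ] EuclideanSpace ℂ (Fin N)).restrictScalars ℝ) β x⟫ =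
      ((εs * (cubeMapFactor A y₀ (modelBasis E n) : ℝ) : ℝ) : ℂ) * g (Torus.repr x) := fun x ↦ by
    rw [inner_weightOp, MForm.toTorus_apply, MForm.toTorus_apply, ContinuousLinearMap.coe_restrictScalars',
      ContinuousLinearEquiv.coe_coe, ContinuousLinearEquiv.symm_apply_apply, ContinuousLinearEquiv.symm_apply_apply,
      scalarWeight, hg, hG]
    push_cast
    ring
  -- assemble
  rw [h1, h2, h3, integral_congr_ae (Eventually.of_forall h4), integral_const_mul, NNReal.smul_def, ← Complex.coe_smul]
  push_cast
  ring

/-! ### The smooth periodic weight -/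

omit [T2Space M] [CompactSpace M] in
/-- The weight operator is smooth on the chart target (finite dimension: test on vectors). [folklore] -/
theorem contDiffOn_weightOp (εs : ℝ) :
    ContDiffOn ℝ ∞ (weightOp o p A ι εs) (extChartAt 𝓘(ℝ, E) p).target := by
  have ho : IsSmoothForm (riemannianVolumeForm o) := Fact.out
  rw [contDiffOn_clm_apply]
  intro v y hy
  have hf : ∀ (s : Set.powersetCard (Fin n) j) i, ContDiffWithinAt ℝ ∞ (fun y ↦ frameTuple p s y i)
      (extChartAt 𝓘(ℝ, E) p).target y := fun s i ↦ contDiffOn_onFrameModel 𝓘(ℝ, E) p _ y hy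
  have hev : ∀ (s : Set.powersetCard (Fin n) j) (w : EuclideanSpace ℂ (Fin N)),
      ContDiffWithinAt ℝ ∞ (fun y ↦ evalFrame p ι s y w) (extChartAt 𝓘(ℝ, E) p).target y := fun s w ↦
    ContDiffWithinAt.continuousAlternatingMap_apply contDiffWithinAt_const (hf s)
  have hr : ∀ s : Set.powersetCard (Fin n) j, ContDiffWithinAt ℝ ∞ (fun y ↦ rieszFrame p ι s y)
      (extChartAt 𝓘(ℝ, E) p).target y := fun s ↦ by
    refine (PiLp.continuousLinearEquiv 2 ℝ (fun _ : Fin N ↦ ℂ)).symm.contDiff.comp_contDiffWithinAt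
      (contDiffWithinAt_pi.2 fun i ↦ ?_)
    exact Complex.conjCLE.contDiff.comp_contDiffWithinAt (hev s _)
  have hw : ContDiffWithinAt ℝ ∞ (scalarWeight o p A εs) (extChartAt 𝓘(ℝ, E) p).target y :=
    contDiffWithinAt_const.mul (ContDiffWithinAt.continuousAlternatingMap_apply_const ((ho.contDiffOn_inChart p) y hy) _)
  have : (fun y ↦ weightOp o p A ι εs y v) = fun y ↦ scalarWeight o p A εs y •
      ∑ s : Set.powersetCard (Fin n) j, evalFrame p ι s y v • rieszFrame p ι s y := funext fun y ↦ weightOp_apply o p A ι εs y v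
  rw [this]
  exact hw.smul (ContDiffWithinAt.sum fun s _ ↦ (hev s v).smul (hr s))

/-- The cut-off weight on `ℝⁿ`: `χ · W(Φ⁻¹ ·)`. [folklore] -/
def weightFun (𝒞 : CubeCutoff p A) (εs : ℝ) :
    EuclideanSpace ℝ (Fin n) → (EuclideanSpace ℂ (Fin N) →L[ℝ] EuclideanSpace ℂ (Fin N)) := fun z ↦
  𝒞.χ z • weightOp o p A ι εs ((cubeMap A (extChartAt 𝓘(ℝ, E) p p)).symm z)

/-- **The smooth periodic weight** `W̃` (cut off to the cube and periodised). [cite: WarnerGTM94, 6.32 (2)] -/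
def weightPer (𝒞 : CubeCutoff p A) (εs : ℝ) :
    UnitAddTorus (Fin n) → (EuclideanSpace ℂ (Fin N) →L[ℝ] EuclideanSpace ℂ (Fin N)) :=
  Torus.periodize (weightFun o ι 𝒞 εs)

omit [T2Space M] [CompactSpace M] in
/-- The cut-off weight is smooth on `ℝⁿ`. [folklore] -/
theorem contDiff_weightFun (𝒞 : CubeCutoff p A) (εs : ℝ) : ContDiff ℝ ∞ (weightFun o ι 𝒞 εs) :=
  contDiff_smul_of_tsupport_subset (CubeCutoff.isOpen_preimage_target p A) 𝒞.contDiff 𝒞.tsupport_subset_preimage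
    ((contDiffOn_weightOp o ι εs).comp (contDiff_cubeMap_symm A _).contDiffOn fun _ hz ↦ hz)

omit [T2Space M] [CompactSpace M] [IsContMDiffRiemannianBundle 𝓘(ℝ, E) ∞ E (fun x : M ↦ TangentSpace 𝓘(ℝ, E) x)]
  [Fact (IsSmoothForm (riemannianVolumeForm o))] in
/-- The cut-off weight is supported in the closed ball of radius `card`. [folklore] -/
theorem tsupport_weightFun_subset (𝒞 : CubeCutoff p A) (εs : ℝ) :
    tsupport (weightFun o ι 𝒞 εs) ⊆ closedBall 0 (Fintype.card (Fin n)) :=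
  Torus.tsupport_subset_closedBall_of_openCube (((tsupport_smul_subset_left _ _).trans
    𝒞.tsupport_subset).trans (closedBall_cubeCenter_subset 𝒞.ρ'_lt))

omit [T2Space M] [CompactSpace M] in
/-- **`W̃` is smooth.** [folklore] -/
theorem isSmooth_weightPer (𝒞 : CubeCutoff p A) (εs : ℝ) : Torus.IsSmooth (weightPer o ι 𝒞 εs) :=
  Torus.isSmooth_periodize (contDiff_weightFun o ι 𝒞 εs) (tsupport_weightFun_subset o ι 𝒞 εs)

omit [T2Space M] [CompactSpace M] [IsContMDiffRiemannianBundle 𝓘(ℝ, E) ∞ E (fun x : M ↦ TangentSpace 𝓘(ℝ, E) x)]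
  [Fact (IsSmoothForm (riemannianVolumeForm o))] in
/-- `W̃ x = W(Φ⁻¹ repr x)` where `repr x ∈ closedBall c₀ ρ` (`χ = 1`). [folklore] -/
theorem weightPer_apply_of_mem (𝒞 : CubeCutoff p A) (εs : ℝ) {x : UnitAddTorus (Fin n)}
    (hx : Torus.repr x ∈ closedBall (Torus.cubeCenter (Fin n)) 𝒞.ρ) :
    weightPer o ι 𝒞 εs x = weightOp o p A ι εs ((cubeMap A (extChartAt 𝓘(ℝ, E) p p)).symm (Torus.repr x)) := by
  rw [weightPer, Torus.periodize_eq_apply_repr (fun z hz ↦ by simp [weightFun, 𝒞.eq_zero_of_not hz]), weightFun,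
    𝒞.eq_one _ hx, one_smul]

/-- **`⟪mk α, mk β⟫ = ∫_{𝕋ⁿ} ⟪W̃(x) Tα(x), Tβ(x)⟫ dx`** for smooth complex forms both supported in the chart
preimage of the inner cube region. [cite: WarnerGTM94, 6.32 (2)] -/
theorem CL2SmoothForms.inner_mk_eq_integral_weightPer (𝒞 : CubeCutoff p A) {εs : ℝ}
    (hsign : ∀ y ∈ cubeRegion A (extChartAt 𝓘(ℝ, E) p p) 𝒞.ρ, chartSign o p y = εs)
    {α β : MForm 𝓘(ℝ, E) M ℂ j} (hα : IsSmoothForm α) (hβ : IsSmoothForm β)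
    (hKα : ∀ x, α x ≠ 0 → x ∈ (extChartAt 𝓘(ℝ, E) p).source ∧
      extChartAt 𝓘(ℝ, E) p x ∈ cubeRegion A (extChartAt 𝓘(ℝ, E) p p) 𝒞.ρ)
    (hKβ : ∀ x, β x ≠ 0 → x ∈ (extChartAt 𝓘(ℝ, E) p).source ∧
      extChartAt 𝓘(ℝ, E) p x ∈ cubeRegion A (extChartAt 𝓘(ℝ, E) p p) 𝒞.ρ) :
    ⟪CL2SmoothForms.mk o α hα, CL2SmoothForms.mk o β hβ⟫ =
      ∫ x, ⟪weightPer o ι 𝒞 εs x (MForm.toTorus p A ((ι : (E [⋀^Fin j]→L[ℝ] ℂ) →L[ℂ] EuclideanSpace ℂ (Fin N)).restrictScalars ℝ) α x),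
        MForm.toTorus p A ((ι : (E [⋀^Fin j]→L[ℝ] ℂ) →L[ℂ] EuclideanSpace ℂ (Fin N)).restrictScalars ℝ) β x⟫ := by
  rw [CL2SmoothForms.inner_mk_eq_integral_inner_weightOp o ι 𝒞 hsign hα hβ hKβ]
  refine integral_congr_ae (Eventually.of_forall fun x ↦ ?_)
  dsimp only
  by_cases hx : MForm.toTorus p A ((ι : (E [⋀^Fin j]→L[ℝ] ℂ) →L[ℂ] EuclideanSpace ℂ (Fin N)).restrictScalars ℝ) α x = 0
  · simp only [hx, map_zero]
  · rw [weightPer_apply_of_mem o ι 𝒞 εs (MForm.toTorus_support _ hKα x hx)]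

omit [T2Space M] [CompactSpace M] in
/-- `x ↦ W̃(x) Tα(x)` is smooth on the torus. [folklore] -/
theorem isSmooth_weightPer_apply_toTorus (𝒞 : CubeCutoff p A) (εs : ℝ) {α : MForm 𝓘(ℝ, E) M ℂ j}
    (hα : IsSmoothForm α)
    (hKα : ∀ x, α x ≠ 0 → x ∈ (extChartAt 𝓘(ℝ, E) p).source ∧
      extChartAt 𝓘(ℝ, E) p x ∈ cubeRegion A (extChartAt 𝓘(ℝ, E) p p) 𝒞.ρ) :
    Torus.IsSmooth fun x ↦ weightPer o ι 𝒞 εs x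
      (MForm.toTorus p A ((ι : (E [⋀^Fin j]→L[ℝ] ℂ) →L[ℂ] EuclideanSpace ℂ (Fin N)).restrictScalars ℝ) α x) := by
  have h1 : Torus.IsSmooth (weightPer o ι 𝒞 εs) := isSmooth_weightPer o ι 𝒞 εs
  have h2 := MForm.isSmooth_toTorus ((ι : (E [⋀^Fin j]→L[ℝ] ℂ) →L[ℂ] EuclideanSpace ℂ (Fin N)).restrictScalars ℝ)
    𝒞.ρ_lt_half hα (𝒞.region_mono.trans 𝒞.region_subset) hKα
  exact ContDiff.clm_apply h1 h2

end TorusIntegral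

/-! ### Polarised vector Parseval and the final identity -/

section Parseval

variable {d : Type*} [Fintype d] {N : Type*} [Fintype N]

/-- A continuous function on the torus is in `L²`. [folklore] -/
theorem Torus.memLp_two_of_continuous {F : Type*} [NormedAddCommGroup F] {f : UnitAddTorus d → F} (hf : Continuous f) :
    MemLp f 2 volume := by
  obtain ⟨C, hC⟩ := (isCompact_univ.image hf).isBounded.exists_norm_le
  exact (memLp_top_of_bound hf.aestronglyMeasurable C (Eventually.of_forall fun x ↦ hC _ ⟨x, mem_univ _, rfl⟩)).mono_exponent
    le_top

/-- **Polarised vector Parseval**: `⟨𝓕f, 𝓕g⟩ = ∫ ⟪f, g⟫` for continuous `ℂ^N`-valued functions on the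
torus (pairing of `LatticePairing`, conjugate-linear in the first slot). [folklore] -/
theorem Torus.pairing_mFourierCoeff_eq_integral_inner {f g : UnitAddTorus d → EuclideanSpace ℂ N}
    (hf : Continuous f) (hg : Continuous g) :
    Lattice.pairing (mFourierCoeff f) (mFourierCoeff g) = ∫ x, ⟪f x, g x⟫ := by
  have hfi : ∀ i, Continuous fun x ↦ f x i := fun i ↦ (EuclideanSpace.proj i : EuclideanSpace ℂ N →L[ℂ] ℂ).continuous.comp hf
  have hgi : ∀ i, Continuous fun x ↦ g x i := fun i ↦ (EuclideanSpace.proj i : EuclideanSpace ℂ N →L[ℂ] ℂ).continuous.comp hg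
  have h : ∀ i, HasSum (fun k ↦ conj (mFourierCoeff (fun x ↦ f x i) k) * mFourierCoeff (fun x ↦ g x i) k)
      (∫ x, conj (f x i) * g x i) := fun i ↦
    Torus.hasSum_conj_mul_mFourierCoeff (Torus.memLp_two_of_continuous (hfi i)) (Torus.memLp_two_of_continuous (hgi i))
  have hsum := hasSum_sum (s := Finset.univ) fun i _ ↦ h i
  have hlhs : (fun k ↦ ∑ i, conj (mFourierCoeff (fun x ↦ f x i) k) * mFourierCoeff (fun x ↦ g x i) k) =
      fun k ↦ ⟪mFourierCoeff f k, mFourierCoeff g k⟫ := by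
    funext k
    rw [PiLp.inner_apply]
    refine Finset.sum_congr rfl fun i _ ↦ ?_
    rw [← Torus.mFourierCoeff_apply_euclidean hf.integrable_unitAddTorus, ← Torus.mFourierCoeff_apply_euclidean hg.integrable_unitAddTorus]
    simp [mul_comm]
  have hrhs : ∑ i, ∫ x, conj (f x i) * g x i = ∫ x, ⟪f x, g x⟫ := by
    rw [← integral_finsetSum _ (f := fun i x ↦ conj (f x i) * g x i) fun i _ ↦
      ((Complex.continuous_conj.comp (hfi i)).mul (hgi i)).integrable_unitAddTorus]
    refine integral_congr_ae (Eventually.of_forall fun x ↦ ?_)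
    dsimp only
    rw [PiLp.inner_apply]
    simp [mul_comm]
  rw [hlhs, hrhs] at hsum
  exact hsum.tsum_eq

end Parseval

section Final

variable {E : Type*} [NormedAddCommGroup E] [NormedSpace ℂ E] [FiniteDimensional ℂ E]
  {n : ℕ} [Fact (finrank ℝ E = n)] [MeasurableSpace E] [BorelSpace E]
  {M : Type*} [TopologicalSpace M] [ChartedSpace E M] [T2Space M] [CompactSpace M]
  [IsManifold 𝓘(ℝ, E) ∞ M] [RiemannianBundle (fun x : M ↦ TangentSpace 𝓘(ℝ, E) x)]
  [IsContMDiffRiemannianBundle 𝓘(ℝ, E) ∞ E (fun x : M ↦ TangentSpace 𝓘(ℝ, E) x)]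
  (o : (x : M) → Orientation ℝ (TangentSpace 𝓘(ℝ, E) x) (Fin n)) {j N : ℕ}
  [Fact (IsSmoothForm (riemannianVolumeForm o))]
  {p : M} {A : E ≃L[ℝ] EuclideanSpace ℝ (Fin n)} (ι : (E [⋀^Fin j]→L[ℝ] ℂ) ≃L[ℂ] EuclideanSpace ℂ (Fin N))

/-- **The `L²` product of `M` as a lattice pairing** (Warner 6.32 (2) `⟨φ, ψ⟩' = ⟨φ, Aψ⟩` on the Fourier
side): `⟪mk α, mk β⟫ = ⟨𝓕(W̃ Tα), 𝓕(Tβ)⟩` for smooth complex forms supported in the chart preimage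
of the inner cube region. [cite: WarnerGTM94, 6.32 (2)] -/
theorem CL2SmoothForms.inner_mk_eq_pairing (𝒞 : CubeCutoff p A) {εs : ℝ}
    (hsign : ∀ y ∈ cubeRegion A (extChartAt 𝓘(ℝ, E) p p) 𝒞.ρ, chartSign o p y = εs)
    {α β : MForm 𝓘(ℝ, E) M ℂ j} (hα : IsSmoothForm α) (hβ : IsSmoothForm β)
    (hKα : ∀ x, α x ≠ 0 → x ∈ (extChartAt 𝓘(ℝ, E) p).source ∧
      extChartAt 𝓘(ℝ, E) p x ∈ cubeRegion A (extChartAt 𝓘(ℝ, E) p p) 𝒞.ρ)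
    (hKβ : ∀ x, β x ≠ 0 → x ∈ (extChartAt 𝓘(ℝ, E) p).source ∧
      extChartAt 𝓘(ℝ, E) p x ∈ cubeRegion A (extChartAt 𝓘(ℝ, E) p p) 𝒞.ρ) :
    ⟪CL2SmoothForms.mk o α hα, CL2SmoothForms.mk o β hβ⟫ =
      Lattice.pairing (mFourierCoeff fun x ↦ weightPer o ι 𝒞 εs x
          (MForm.toTorus p A ((ι : (E [⋀^Fin j]→L[ℝ] ℂ) →L[ℂ] EuclideanSpace ℂ (Fin N)).restrictScalars ℝ) α x))
        (mFourierCoeff (MForm.toTorus p A ((ι : (E [⋀^Fin j]→L[ℝ] ℂ) →L[ℂ] EuclideanSpace ℂ (Fin N)).restrictScalars ℝ) β)) := by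
  rw [CL2SmoothForms.inner_mk_eq_integral_weightPer o ι 𝒞 hsign hα hβ hKα hKβ,
    Torus.pairing_mFourierCoeff_eq_integral_inner (isSmooth_weightPer_apply_toTorus o ι 𝒞 εs hα hKα).continuous
      (MForm.isSmooth_toTorus _ 𝒞.ρ_lt_half hβ (𝒞.region_mono.trans 𝒞.region_subset) hKβ).continuous]

end Final

end Literature.Geometry.Kaehler
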